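import Summits.AnomalousDissipation.AnomalousDissipation.Theorems.SolenoidalFractalHomogenisationLagrangianStepVmodFrameDefsJ
import Literature.Analysis.FluidPDE.PassiveVectorTensorDistortedFrameTest
import HarnessLib

/-!
# K1L_D (stmt-AnomalousDissipation-27980), (ℓ3-A) road A, (S1a): SPACE DERIVATIVES of the frame-corrected field `J•ζ` — product-rule formulas and
# POINTWISE bounds keeping the test factors `ζ(y), ∂ζ(y), ∂²ζ(y)` explicit (the input of the L²-form (S1) N-bound, RULING D28-18 (5))
(helper; `--supports 27980 --as helper`; prover ad-k1loc-p3 g11.)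

For a matrix field `Jt : 𝕋³ → Matrix (Fin 3) (Fin 3) ℝ` with `C²` entries bounded by `|Jt| ≤ C₀`, `|∂Jt| ≤ C₁`, `|∂²Jt| ≤ C₂` and a smooth `ζ : 𝕋³ → ℝ³`:
* `partialDeriv_distort_apply` — `∂_c (Jt•ζ)(y)_a = Σ_m (∂_c J_am · ζ_m + J_am · ∂_c ζ_m)(y)`;
* `abs_partialDeriv_distort_apply_le` — `|∂_c (Jt•ζ)(y)_a| ≤ 3·(C₁·‖ζ y‖ + C₀·‖∂_c ζ y‖)`;
* `partialDeriv₂_distort_apply` — `∂_e∂_c (Jt•ζ)(y)_a = Σ_m (∂_e∂_cJ·ζ + ∂_cJ·∂_eζ + ∂_eJ·∂_cζ + J·∂_e∂_cζ)_m(y)`;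
* `abs_partialDeriv₂_distort_apply_le` — `|∂_e∂_c (Jt•ζ)(y)_a| ≤ 3·(C₂‖ζ y‖ + C₁(‖∂_eζ y‖ + ‖∂_cζ y‖) + C₀‖∂_e∂_cζ y‖)`.
POINTWISE in `y` on the `ζ`-side (so that squaring and integrating gives the L² bound with `‖ζ‖₂, ‖∂ζ‖₂, ‖∂²ζ‖₂` — NOT sup norms of `ζ`).
`sorry`-free; NOT a proof of any block, of K1L_D or of AD; rung F-D1.A0.
-/

set_option linter.dupNamespace false

noncomputable section

namespace Summit.AnomalousDissipation.AnomalousDissipation.Theorems.SolenoidalFractalHomogenisation.LagrangianStep.VmodDist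

open Literature.Analysis Literature.Analysis.FluidPDE Literature.Analysis.FunctionSpaces
open Set

variable {Jt : UnitAddTorus (Fin 3) → Matrix (Fin 3) (Fin 3) ℝ} {ζ : VF}

/-- A component of an `ℝ³` vector is bounded by its norm. -/
theorem abs_apply_le_norm (v : EuclideanSpace ℝ (Fin 3)) (m : Fin 3) : |v m| ≤ ‖v‖ := by
  rw [← Real.norm_eq_abs]; exact PiLp.norm_apply_le v m

/-! ## §1 First derivatives -/

/-- **Product rule for the corrected field, first order**: `∂_c (Jt•ζ)(y)_a = Σ_m (∂_c J_am(y) ζ_m(y) + J_am(y) ∂_c ζ_m(y))`. -/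
theorem partialDeriv_distort_apply (hJ : ∀ a m, Torus.IsSmooth (fun y => Jt y a m)) (hζ : Torus.IsSmooth ζ)
    (c : Fin 3) (y : UnitAddTorus (Fin 3)) (a : Fin 3) :
    (Torus.partialDeriv c (Torus.distort Jt ζ) y) a
      = ∑ m, (Torus.partialDeriv c (fun y => Jt y a m) y * ζ y m + Jt y a m * (Torus.partialDeriv c ζ y) m) := by
  have h1 : (Torus.partialDeriv c (Torus.distort Jt ζ) y) a = Torus.partialDeriv c (fun y => Torus.distort Jt ζ y a) y :=
    (Torus.partialDeriv_apply_coord ((Torus.isSmooth_distort hJ hζ).isContDiff (by simp)) c y a).symm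
  rw [h1, show (fun y => Torus.distort Jt ζ y a) = fun y => ∑ m, Jt y a m * ζ y m from funext fun y => Torus.distort_apply_eq_sum Jt ζ y a]
  have hJ1 : ∀ m, Torus.IsContDiff 1 (fun y => Jt y a m) := fun m => (hJ a m).isContDiff (by simp)
  have hζ1 : ∀ m, Torus.IsContDiff 1 (fun y => ζ y m) := fun m => (hζ.apply m).isContDiff (by simp)
  have hprod : ∀ m ∈ (Finset.univ : Finset (Fin 3)), Torus.IsContDiff 1 (fun y => Jt y a m * ζ y m) := fun m _ => by
    unfold Torus.IsContDiff; exact (hJ1 m).mul (hζ1 m)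
  rw [Torus.partialDeriv_finset_sum _ hprod]
  refine Finset.sum_congr rfl fun m _ => ?_
  rw [Torus.partialDeriv_mul (hJ1 m) (hζ1 m), Torus.partialDeriv_apply_coord (hζ.isContDiff (by simp)) c y m]
  ring

/-- **Pointwise bound, first order**: `|∂_c (Jt•ζ)(y)_a| ≤ 3·(C₁‖ζ y‖ + C₀‖∂_c ζ y‖)` for `|Jt| ≤ C₀`, `|∂Jt| ≤ C₁`. -/
theorem abs_partialDeriv_distort_apply_le (hJ : ∀ a m, Torus.IsSmooth (fun y => Jt y a m)) (hζ : Torus.IsSmooth ζ)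
    {C₀ C₁ : ℝ} (hC0 : 0 ≤ C₀) (hC1 : 0 ≤ C₁) (hJ0 : ∀ y a m, |Jt y a m| ≤ C₀) (hJ1 : ∀ y a m c, |Torus.partialDeriv c (fun y => Jt y a m) y| ≤ C₁)
    (c : Fin 3) (y : UnitAddTorus (Fin 3)) (a : Fin 3) :
    |(Torus.partialDeriv c (Torus.distort Jt ζ) y) a| ≤ 3 * (C₁ * ‖ζ y‖ + C₀ * ‖Torus.partialDeriv c ζ y‖) := by
  rw [partialDeriv_distort_apply hJ hζ c y a]
  refine (Finset.abs_sum_le_sum_abs _ _).trans ?_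
  have : ∀ m ∈ (Finset.univ : Finset (Fin 3)), |Torus.partialDeriv c (fun y => Jt y a m) y * ζ y m + Jt y a m * (Torus.partialDeriv c ζ y) m|
      ≤ C₁ * ‖ζ y‖ + C₀ * ‖Torus.partialDeriv c ζ y‖ := fun m _ => by
    refine (abs_add_le _ _).trans (add_le_add ?_ ?_)
    · rw [abs_mul]; exact mul_le_mul (hJ1 y a m c) (abs_apply_le_norm _ m) (abs_nonneg _) hC1
    · rw [abs_mul]; exact mul_le_mul (hJ0 y a m) (abs_apply_le_norm _ m) (abs_nonneg _) hC0
  refine (Finset.sum_le_sum this).trans ?_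
  simp only [Finset.sum_const, Finset.card_univ, Fintype.card_fin, nsmul_eq_mul]; push_cast; linarith

/-! ## §2 Second derivatives -/

/-- **Product rule for the corrected field, second order**:
`∂_e∂_c (Jt•ζ)(y)_a = Σ_m (∂_e∂_cJ·ζ + ∂_cJ·∂_eζ + ∂_eJ·∂_cζ + J·∂_e∂_cζ)_{am}(y)`. -/
theorem partialDeriv₂_distort_apply (hJ : ∀ a m, Torus.IsSmooth (fun y => Jt y a m)) (hζ : Torus.IsSmooth ζ)
    (e c : Fin 3) (y : UnitAddTorus (Fin 3)) (a : Fin 3) :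
    (Torus.partialDeriv e (Torus.partialDeriv c (Torus.distort Jt ζ)) y) a
      = ∑ m, (Torus.partialDeriv e (Torus.partialDeriv c (fun y => Jt y a m)) y * ζ y m
          + Torus.partialDeriv c (fun y => Jt y a m) y * (Torus.partialDeriv e ζ y) m
          + Torus.partialDeriv e (fun y => Jt y a m) y * (Torus.partialDeriv c ζ y) m
          + Jt y a m * (Torus.partialDeriv e (Torus.partialDeriv c ζ) y) m) := by
  have hD : Torus.IsSmooth (Torus.distort Jt ζ) := Torus.isSmooth_distort hJ hζ
  have h1 : (Torus.partialDeriv e (Torus.partialDeriv c (Torus.distort Jt ζ)) y) a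
      = Torus.partialDeriv e (fun y => (Torus.partialDeriv c (Torus.distort Jt ζ) y) a) y :=
    (Torus.partialDeriv_apply_coord ((hD.partialDeriv c).isContDiff (by simp)) e y a).symm
  rw [h1, show (fun y => (Torus.partialDeriv c (Torus.distort Jt ζ) y) a)
      = fun y => ∑ m, (Torus.partialDeriv c (fun y => Jt y a m) y * ζ y m + Jt y a m * (Torus.partialDeriv c ζ y) m) from
    funext fun y => partialDeriv_distort_apply hJ hζ c y a]
  -- regularity of the summands
  have hJ1 : ∀ m, Torus.IsContDiff 1 (fun y => Jt y a m) := fun m => (hJ a m).isContDiff (by simp)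
  have hdJ1 : ∀ m, Torus.IsContDiff 1 (Torus.partialDeriv c (fun y => Jt y a m)) := fun m => ((hJ a m).partialDeriv c).isContDiff (by simp)
  have hζ1 : ∀ m, Torus.IsContDiff 1 (fun y => ζ y m) := fun m => (hζ.apply m).isContDiff (by simp)
  have hdζ1 : ∀ m, Torus.IsContDiff 1 (fun y => (Torus.partialDeriv c ζ y) m) := fun m => ((hζ.partialDeriv c).apply m).isContDiff (by simp)
  have hs1 : ∀ m, Torus.IsContDiff 1 (fun y => Torus.partialDeriv c (fun y => Jt y a m) y * ζ y m) := fun m => by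
    unfold Torus.IsContDiff; exact (hdJ1 m).mul (hζ1 m)
  have hs2 : ∀ m, Torus.IsContDiff 1 (fun y => Jt y a m * (Torus.partialDeriv c ζ y) m) := fun m => by
    unfold Torus.IsContDiff; exact (hJ1 m).mul (hdζ1 m)
  have hsum : ∀ m ∈ (Finset.univ : Finset (Fin 3)),
      Torus.IsContDiff 1 (fun y => Torus.partialDeriv c (fun y => Jt y a m) y * ζ y m + Jt y a m * (Torus.partialDeriv c ζ y) m) := fun m _ => by
    unfold Torus.IsContDiff; exact (hs1 m).add (hs2 m)
  rw [Torus.partialDeriv_finset_sum _ hsum]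
  refine Finset.sum_congr rfl fun m _ => ?_
  have hadd : Torus.partialDeriv e (fun y => Torus.partialDeriv c (fun y => Jt y a m) y * ζ y m + Jt y a m * (Torus.partialDeriv c ζ y) m) y
      = Torus.partialDeriv e (fun y => Torus.partialDeriv c (fun y => Jt y a m) y * ζ y m) y
        + Torus.partialDeriv e (fun y => Jt y a m * (Torus.partialDeriv c ζ y) m) y := by
    have h := congrFun (Torus.partialDeriv_add (hs1 m) (hs2 m) e) y
    exact h
  rw [hadd, Torus.partialDeriv_mul (hdJ1 m) (hζ1 m), Torus.partialDeriv_mul (hJ1 m) (hdζ1 m),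
    Torus.partialDeriv_apply_coord (hζ.isContDiff (by simp)) e y m,
    Torus.partialDeriv_apply_coord ((hζ.partialDeriv c).isContDiff (by simp)) e y m]
  ring

/-- **Pointwise bound, second order**: `|∂_e∂_c (Jt•ζ)(y)_a| ≤ 3·(C₂‖ζ y‖ + C₁(‖∂_eζ y‖ + ‖∂_cζ y‖) + C₀‖∂_e∂_cζ y‖)`. -/
theorem abs_partialDeriv₂_distort_apply_le (hJ : ∀ a m, Torus.IsSmooth (fun y => Jt y a m)) (hζ : Torus.IsSmooth ζ)
    {C₀ C₁ C₂ : ℝ} (hC0 : 0 ≤ C₀) (hC1 : 0 ≤ C₁) (hC2 : 0 ≤ C₂) (hJ0 : ∀ y a m, |Jt y a m| ≤ C₀)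
    (hJ1 : ∀ y a m c, |Torus.partialDeriv c (fun y => Jt y a m) y| ≤ C₁)
    (hJ2 : ∀ y a m c e, |Torus.partialDeriv e (Torus.partialDeriv c (fun y => Jt y a m)) y| ≤ C₂)
    (e c : Fin 3) (y : UnitAddTorus (Fin 3)) (a : Fin 3) :
    |(Torus.partialDeriv e (Torus.partialDeriv c (Torus.distort Jt ζ)) y) a|
      ≤ 3 * (C₂ * ‖ζ y‖ + C₁ * (‖Torus.partialDeriv e ζ y‖ + ‖Torus.partialDeriv c ζ y‖)
          + C₀ * ‖Torus.partialDeriv e (Torus.partialDeriv c ζ) y‖) := by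
  rw [partialDeriv₂_distort_apply hJ hζ e c y a]
  refine (Finset.abs_sum_le_sum_abs _ _).trans ?_
  have : ∀ m ∈ (Finset.univ : Finset (Fin 3)),
      |Torus.partialDeriv e (Torus.partialDeriv c (fun y => Jt y a m)) y * ζ y m
          + Torus.partialDeriv c (fun y => Jt y a m) y * (Torus.partialDeriv e ζ y) m
          + Torus.partialDeriv e (fun y => Jt y a m) y * (Torus.partialDeriv c ζ y) m
          + Jt y a m * (Torus.partialDeriv e (Torus.partialDeriv c ζ) y) m|
      ≤ C₂ * ‖ζ y‖ + C₁ * (‖Torus.partialDeriv e ζ y‖ + ‖Torus.partialDeriv c ζ y‖)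
          + C₀ * ‖Torus.partialDeriv e (Torus.partialDeriv c ζ) y‖ := fun m _ => by
    have t1 : |Torus.partialDeriv e (Torus.partialDeriv c (fun y => Jt y a m)) y * ζ y m| ≤ C₂ * ‖ζ y‖ := by
      rw [abs_mul]; exact mul_le_mul (hJ2 y a m c e) (abs_apply_le_norm _ m) (abs_nonneg _) hC2
    have t2 : |Torus.partialDeriv c (fun y => Jt y a m) y * (Torus.partialDeriv e ζ y) m| ≤ C₁ * ‖Torus.partialDeriv e ζ y‖ := by
      rw [abs_mul]; exact mul_le_mul (hJ1 y a m c) (abs_apply_le_norm _ m) (abs_nonneg _) hC1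
    have t3 : |Torus.partialDeriv e (fun y => Jt y a m) y * (Torus.partialDeriv c ζ y) m| ≤ C₁ * ‖Torus.partialDeriv c ζ y‖ := by
      rw [abs_mul]; exact mul_le_mul (hJ1 y a m e) (abs_apply_le_norm _ m) (abs_nonneg _) hC1
    have t4 : |Jt y a m * (Torus.partialDeriv e (Torus.partialDeriv c ζ) y) m| ≤ C₀ * ‖Torus.partialDeriv e (Torus.partialDeriv c ζ) y‖ := by
      rw [abs_mul]; exact mul_le_mul (hJ0 y a m) (abs_apply_le_norm _ m) (abs_nonneg _) hC0
    have := abs_add_three (Torus.partialDeriv e (Torus.partialDeriv c (fun y => Jt y a m)) y * ζ y m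
        + Torus.partialDeriv c (fun y => Jt y a m) y * (Torus.partialDeriv e ζ y) m)
      (Torus.partialDeriv e (fun y => Jt y a m) y * (Torus.partialDeriv c ζ y) m)
      (Jt y a m * (Torus.partialDeriv e (Torus.partialDeriv c ζ) y) m)
    have h12 := abs_add_le (Torus.partialDeriv e (Torus.partialDeriv c (fun y => Jt y a m)) y * ζ y m)
      (Torus.partialDeriv c (fun y => Jt y a m) y * (Torus.partialDeriv e ζ y) m)
    linarith
  refine (Finset.sum_le_sum this).trans ?_
  simp only [Finset.sum_const, Finset.card_univ, Fintype.card_fin, nsmul_eq_mul]; push_cast; linarith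

end Summit.AnomalousDissipation.AnomalousDissipation.Theorems.SolenoidalFractalHomogenisation.LagrangianStep.VmodDist

end
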